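import Summits.ValiantsHypothesis.ValiantsHypothesis.Theorems.LacunarySymmetroidMatrixDescartesCensusCUSoundForms
import Summits.ValiantsHypothesis.ValiantsHypothesis.Theorems.LacunarySymmetroidMatrixDescartesCensusV20SoundTwenty

/-!
# `MatrixDescartes` census — soundness of the chamber-uniform checker, part 3: the model, magnitude rows

HONEST FRAMING.  Object-search cell `pub-symmetroid`; door-A item `DoorA26 = PosRootLawAt 2 6 19`
(stmt-ValiantsHypothesis-19979; OPEN, typed, never asserted).  The abstract MODEL a hypothetical twenty supplies to the chamber-uniform
checker (`CU.Model` = the `V = 20` model of `…CensusV20Model` + the rank rows `M4 = 0` + the T rows), the semantics of magnitude rows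
(`CU.LRow.Holds`: `Σ w_t log x_t ≤ log (kn/kd)`) with the soundness of the row builder (`CU.buildLRow_sound`) and the bridge between the
`V20` pair sums and the `CU` pair-sum forms; the Newton cone / Abel–transport part follows in `…CensusCUSoundNewton`.  Nothing here bears
on `V = 19`, on `DoorA26` itself (OPEN), on `MatrixDescartes` (stmt-ValiantsHypothesis-18050) or on `VP ≠ VNP`.

[folklore] Certificate-checker soundness; elementary.
-/

-- the D-0017 layout repeats a namespace component (single-conjunct summit); the `dupNamespace` linter flags it; name mandated.
set_option linter.dupNamespace false

namespace Summit.ValiantsHypothesis.ValiantsHypothesis.Theorems.LacunarySymmetroidMatrixDescartes.Census.CU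

open V20 (Atom Term PolySpec allAtoms posOf qA cA termNeg posTerms posl negAt fval Row RowSpec buildRow lprod pval tval sgnR
  Epos sums dist1 ordOK psum)
open Finset

/-! ## The model -/

/-- What a hypothetical twenty of orientation `s` supplies to the chamber-uniform checker: the `V = 20` model (positive absolute
values `x` at the 21 positions, the signed atom valuation `v`, Newton-cone rows, `G3 / RCS / W ≥ 0`, no odd definite triangle) plus
the rank rows `M4(r | c) = 0` and the T rows `|β_ik| q_j ≤ 4 |β_ij| |β_jk|` (three definite letters). [folklore] -/
structure Model (dl : List ℕ) (ord : List Atom) (s : Bool) (x : ℕ → ℝ) (v : Atom → ℝ) : Prop where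
  /-- the `V = 20` model -/
  toV20 : V20.Model dl ord s x v
  /-- rank rows: the `4 × 4` Gram minors vanish -/
  m4 : ∀ r c : List ℕ, r.length = 4 → c.length = 4 → (∀ i ∈ r, i < 6) → (∀ i ∈ c, i < 6) → pval v (m4Poly r c) = 0
  /-- T rows -/
  trow : ∀ i j k : ℕ, i < 6 → j < 6 → k < 6 → i ≠ j → j ≠ k → i ≠ k →
    0 < v (qA i) → 0 < v (qA j) → 0 < v (qA k) → |v (cA i k)| * v (qA j) ≤ 4 * |v (cA i j)| * |v (cA j k)|

/-- The support as a list. [folklore] -/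
def dlist (d : Fin 6 → ℕ) : List ℕ := [d 0, d 1, d 2, d 3, d 4, d 5]

/-- The log-absolute coefficients `ℓ_t = log x_t`. [folklore] -/
noncomputable def ell (x : ℕ → ℝ) : ℕ → ℝ := fun t => Real.log (x t)

/-- A magnitude row holds for `ℓ`: `Σ w_t ℓ_t ≤ log (kn / kd)`. [folklore] -/
def LRow.Holds (ℓ : ℕ → ℝ) (r : LRow) : Prop := vdot r.w ℓ ≤ Real.log ((r.kn : ℝ) / r.kd)

/-- A magnitude row is well formed: positive constants, 21 weights. [folklore] -/
def LRow.WF (r : LRow) : Prop := 0 < r.kn ∧ 0 < r.kd ∧ r.w.length = 21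

variable {dl : List ℕ} {ord : List Atom} {s : Bool} {x : ℕ → ℝ} {v : Atom → ℝ}

/-! ## Basic facts about the model -/

/-- `log ∏ x = Σ log x`. [folklore] -/
theorem log_lprod (hx : ∀ t, 0 < x t) : ∀ ps : List ℕ, Real.log (lprod x ps) = (ps.map (ell x)).sum
  | [] => by simp [lprod]
  | p :: ps => by
    have h1 : lprod x (p :: ps) = x p * lprod x ps := by simp [lprod]
    rw [h1, Real.log_mul (hx p).ne' (V20.lprod_pos hx ps).ne', log_lprod hx ps]
    simp [ell]

/-- Absolute value of an atom = the absolute coefficient at its position. [folklore] -/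
theorem abs_v_eq (M : V20.Model dl ord s x v) {a : Atom} (ha : a ∈ allAtoms) : |v a| = x (posOf a ord) := by
  rw [M.hv a ha]
  unfold sgnR
  split_ifs <;> simp [abs_of_pos (M.xpos _)]

/-- A definite atom evaluates to the absolute coefficient. [folklore] -/
theorem v_qA_eq (M : V20.Model dl ord s x v) {i : ℕ} (hi : i < 6) (hpos : 0 < v (qA i)) : v (qA i) = x (posOf (qA i) ord) := by
  rw [← abs_v_eq M (V20.qA_mem hi), abs_of_pos hpos]

/-- The support list has six entries. [folklore] -/
theorem length_dlist (d : Fin 6 → ℕ) : (dlist d).length = 6 := rfl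

/-- Entries of the support list. [folklore] -/
theorem getD_dlist (d : Fin 6 → ℕ) {i : ℕ} (hi : i < 6) : (dlist d).getD i 0 = d ⟨i, hi⟩ := by
  interval_cases i <;> rfl

/-- The order check of `CU` unpacked. [folklore] -/
theorem ordAtomsOK_spec (h : ordAtomsOK ord = true) :
    ord.length = 21 ∧ (∀ a ∈ allAtoms, a ∈ ord) ∧ (∀ b ∈ ord, b ∈ allAtoms) := by
  simpa [ordAtomsOK, Bool.and_eq_true, decide_eq_true_eq, and_assoc] using h

/-- The atom at a position `< 21` is an atom. [folklore] -/
theorem getD_mem_allAtoms (h : ordAtomsOK ord = true) {t : ℕ} (ht : t < 21) : ord.getD t (0, 0) ∈ allAtoms := by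
  obtain ⟨hlen, -, hall⟩ := ordAtomsOK_spec h
  rw [List.getD_eq_getElem _ _ (by rw [hlen]; exact ht)]
  exact hall _ (List.getElem_mem _)

/-- **Bridge**: the `V20` pair sum at a position is the value of the `CU` pair-sum form. [folklore] -/
theorem Epos_eq_ev (d : Fin 6 → ℕ) (h : ordAtomsOK ord = true) {t : ℕ} (ht : t < 21) :
    ((Epos (dlist d) ord t : ℕ) : ℤ) = (Eform ord t).ev d := by
  have ha := getD_mem_allAtoms h ht
  rw [V20.mem_allAtoms_iff] at ha
  have h1 : (ord.getD t (0, 0)).1 < 6 := by omega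
  have h2 : (ord.getD t (0, 0)).2 < 6 := ha.2
  unfold Epos psum Eform
  rw [ev_atomForm d h1 h2, getD_dlist d h1, getD_dlist d h2]
  push_cast; rfl

/-- The value of a pair form is the difference of the pair sums. [folklore] -/
theorem ev_pairForm (d : Fin 6 → ℕ) (p : ℕ × ℕ) :
    (pairForm ord p).ev d = (Eform ord p.2).ev d - (Eform ord p.1).ev d := by
  rw [pairForm, ev_ldSub]

/-! ## Magnitude rows -/

/-- A checked `V20` row, read logarithmically. [folklore] -/
theorem lrowOfRow_holds (hx : ∀ t, 0 < x t) {r : Row} (hr : r.Holds x) (hwf : r.WF) :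
    (lrowOfRow r).Holds (ell x) ∧ (lrowOfRow r).WF := by
  obtain ⟨hL, hR, hBn, hBd⟩ := hwf
  have hden := V20.fval_pos hBd
  have hnum := V20.fval_pos hBn
  have hpL := V20.lprod_pos hx r.L
  have hpR := V20.lprod_pos hx r.R
  refine ⟨?_, hnum, hden, by rw [lrowOfRow, length_vbumps, length_vbumps, length_z21]⟩
  unfold LRow.Holds
  have hw : vdot (lrowOfRow r).w (ell x) = (r.L.map (ell x)).sum - (r.R.map (ell x)).sum := by
    rw [lrowOfRow, vdot_vbumps _ _ _ _ (fun p hp => by rw [length_vbumps, length_z21]; exact hR p hp),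
      vdot_vbumps _ _ _ _ (fun p hp => by rw [length_z21]; exact hL p hp), vdot_z21]
    ring
  rw [hw, ← log_lprod hx, ← log_lprod hx, lrowOfRow]
  simp only
  have h1 : Real.log (lprod x r.L * (fval r.Bden : ℝ)) ≤ Real.log (lprod x r.R * (fval r.Bnum : ℝ)) :=
    Real.log_le_log (by positivity) hr
  rw [Real.log_mul hpL.ne' (by positivity), Real.log_mul hpR.ne' (by positivity)] at h1
  rw [Real.log_div (by positivity) (by positivity)]
  linarith

/-- The T row holds in the model. [folklore] -/
theorem trowL_holds (M : Model dl ord s x v) {i j k : ℕ} (h : trowOK ord s i j k = true) :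
    (trowL ord i j k).Holds (ell x) ∧ (trowL ord i j k).WF := by
  unfold trowOK at h
  simp only [Bool.and_eq_true, decide_eq_true_eq, Bool.not_eq_true'] at h
  obtain ⟨⟨⟨⟨hi, hj, hk, hij, hjk, hik⟩, hpi⟩, hpj⟩, hpk⟩ := h
  have MV := M.toV20
  have hqi := (MV.v_qA_pos_iff hi).2 hpi
  have hqj := (MV.v_qA_pos_iff hj).2 hpj
  have hqk := (MV.v_qA_pos_iff hk).2 hpk
  have ht := M.trow i j k hi hj hk hij hjk hik hqi hqj hqk
  rw [abs_v_eq MV (V20.cA_mem hi hk), abs_v_eq MV (V20.cA_mem hi hj), abs_v_eq MV (V20.cA_mem hj hk),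
    v_qA_eq MV hj hqj] at ht
  have hx := MV.xpos
  refine ⟨?_, by unfold trowL; norm_num, by unfold trowL; norm_num, by rw [trowL, length_vbumps, length_vbumps, length_z21]⟩
  unfold LRow.Holds
  have hw : vdot (trowL ord i j k).w (ell x) = ell x (posOf (cA i k) ord) + ell x (posOf (qA j) ord)
      - (ell x (posOf (cA i j) ord) + ell x (posOf (cA j k) ord)) := by
    rw [trowL, vdot_vbumps _ _ _ _ (fun p hp => by
        rw [length_vbumps, length_z21]; simp only [List.mem_cons, List.mem_nil_iff, or_false] at hp
        rcases hp with rfl | rfl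
        · exact V20.posOf_lt_21 MV (V20.cA_mem hi hj)
        · exact V20.posOf_lt_21 MV (V20.cA_mem hj hk)),
      vdot_vbumps _ _ _ _ (fun p hp => by
        rw [length_z21]; simp only [List.mem_cons, List.mem_nil_iff, or_false] at hp
        rcases hp with rfl | rfl
        · exact V20.posOf_lt_21 MV (V20.cA_mem hi hk)
        · exact V20.posOf_lt_21 MV (V20.qA_mem hj)), vdot_z21]
    simp; ring
  rw [hw, trowL]
  simp only [ell, Nat.cast_ofNat, Nat.cast_one, div_one]
  have h1 : Real.log (x (posOf (cA i k) ord) * x (posOf (qA j) ord))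
      ≤ Real.log (4 * x (posOf (cA i j) ord) * x (posOf (cA j k) ord)) :=
    Real.log_le_log (mul_pos (hx _) (hx _)) ht
  rw [Real.log_mul (hx _).ne' (hx _).ne', Real.log_mul (mul_pos (by norm_num) (hx _)).ne' (hx _).ne',
    Real.log_mul (by norm_num) (hx _).ne'] at h1
  linarith

/-- **Soundness of the row builder**: every magnitude row the checker builds holds in the model (given that the context rows do). [folklore] -/
theorem buildLRow_sound (M : Model dl ord s x v) {ctxL : List LRow} (hctxL : ∀ r ∈ ctxL, r.Holds (ell x) ∧ r.WF)
    {ls : LSpec} {r : LRow} (h : buildLRow ctxL ord s ls = some r) : r.Holds (ell x) ∧ r.WF := by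
  cases ls with
  | gram rs =>
    cases rs with
    | c25 t => simp [buildLRow] at h
    | one P n =>
      simp only [buildLRow, Option.map_eq_some_iff] at h
      obtain ⟨r0, hr0, rfl⟩ := h
      have hb : buildRow dl ord s (.one P n) = some r0 := hr0
      obtain ⟨hh, hwf⟩ := V20.buildRow_sound M.toV20 hb
      exact lrowOfRow_holds M.toV20.xpos hh hwf
    | amgm P S =>
      simp only [buildLRow, Option.map_eq_some_iff] at h
      obtain ⟨r0, hr0, rfl⟩ := h
      have hb : buildRow dl ord s (.amgm P S) = some r0 := hr0
      obtain ⟨hh, hwf⟩ := V20.buildRow_sound M.toV20 hb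
      exact lrowOfRow_holds M.toV20.xpos hh hwf
  | trow i j k =>
    simp only [buildLRow] at h
    split_ifs at h with hok
    cases h
    exact trowL_holds M hok
  | ctx i =>
    simp only [buildLRow] at h
    exact hctxL r (List.mem_of_getElem? h)

/-- All rows of a competitor hold. [folklore] -/
theorem buildLRows_sound (M : Model dl ord s x v) {ctxL : List LRow} (hctxL : ∀ r ∈ ctxL, r.Holds (ell x) ∧ r.WF) :
    ∀ {specs : List (LSpec × ℕ)} {rs : List (LRow × ℕ)}, buildLRows ctxL ord s specs = some rs →
      ∀ rn ∈ rs, rn.1.Holds (ell x) ∧ rn.1.WF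
  | [], rs, h => by simp [buildLRows] at h; subst h; simp
  | (ls, n) :: rest, rs, h => by
    simp only [buildLRows] at h
    split at h
    · next r rr h1 h2 =>
      cases h
      intro rn hrn
      rcases List.mem_cons.1 hrn with rfl | hrn
      · exact buildLRow_sound M hctxL h1
      · exact buildLRows_sound M hctxL h2 rn hrn
    · simp at h

/-- `Σ y_r (w_r · ℓ) ≤ log ∏ (kn_r/kd_r)^{y_r}`, and the weight vector has 21 entries. [folklore] -/
theorem rowsWeight_le {ℓ : ℕ → ℝ} : ∀ {rs : List (LRow × ℕ)}, (∀ rn ∈ rs, rn.1.Holds ℓ ∧ rn.1.WF) →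
    vdot (rowsWeight rs) ℓ ≤ Real.log (rowsConst rs : ℝ) ∧ (rowsWeight rs).length = 21 ∧ 0 < rowsConst rs
  | [], _ => by simp [rowsWeight, rowsConst, vdot_z21, length_z21]
  | (r, n) :: rest, h => by
    obtain ⟨ih1, ih2, ih3⟩ := rowsWeight_le (rs := rest) (fun rn hrn => h rn (List.mem_cons_of_mem _ hrn))
    obtain ⟨hr, hkn, hkd, hw⟩ := h (r, n) (by simp)
    have hq : (0 : ℚ) < (r.kn : ℚ) / r.kd := by positivity
    refine ⟨?_, by rw [rowsWeight, length_vAdd (by rw [length_vSmul, hw, ih2]), length_vSmul, hw], ?_⟩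
    · rw [rowsWeight, vdot_vAdd _ (by rw [length_vSmul, hw, ih2]), vdot_vSmul, rowsConst]
      push_cast
      rw [Real.log_mul (by positivity) (by exact_mod_cast ih3.ne'), Real.log_pow]
      have : (n : ℝ) * vdot r.w ℓ ≤ (n : ℝ) * Real.log ((r.kn : ℝ) / r.kd) :=
        mul_le_mul_of_nonneg_left hr (by positivity)
      linarith
    · rw [rowsConst]; positivity

end Summit.ValiantsHypothesis.ValiantsHypothesis.Theorems.LacunarySymmetroidMatrixDescartes.Census.CU
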